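import Summits.QuantumFields.YangMills.Theorems.ColdStartUniversalityLatticeLangevinGaussShiftVec
import Literature.Probability.Process.BrownianVec
import HarnessLib

/-!
# Route `ColdStartUniversality`, crux K_A1 `UniformColdStartMixing` (stmt-QuantumFields-24809), rung `stub_fixedCutoffMixing`:
# E-block brick 4b — the grid increments of a Brownian vector are i.i.d. `gaussVec`

Helper file (seat `ym-line-csu-p1`, g7).  For a `d`-dimensional Brownian motion `W` (tree `IsBrownianVec`) and a step `h`, the
vector of increments `ξ_i = W_{(i+1)h} - W_{ih}`, `i < n`, has law `⊗_{i<n} gaussVec d h` (`map_increments_eq_pi`): induction on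
`n`, splitting off the first increment (`= W_h`, law `gaussVec d h`), which is independent of the later ones (functions of the
shifted path `vecShift W h`, whose law is that of the path: `indep_shift`, `map_shift`).  This identifies the driving noise of
Euler schemes with the product Gaussian space of the discrete Girsanov formula `integral_comp_shift_mul_girsanovWeight`.
No definition, no sorry.  RECORD-rung R3 plumbing; nothing here bears on the mass gap.
-/

set_option autoImplicit false

noncomputable section

namespace Summit.QuantumFields.YangMills.Theorems.ColdStartUniversality

open MeasureTheory ProbabilityTheory Filter Finset
open scoped NNReal ENNReal BigOperators
open Literature.Probability.Process (gaussVec vecPath vecShift vecPast IsBrownianVec)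

/-- The increment functional on paths: `p ↦ (i ↦ p((i+1)h) - p(ih))` is measurable. [folklore] -/
theorem measurable_pathIncrements (d n : ℕ) (h : ℝ≥0) :
    Measurable fun p : ℝ≥0 → (Fin d → ℝ) => fun i : Fin n => p ((((i : ℕ) + 1 : ℕ) : ℝ≥0) * h) - p (((i : ℕ) : ℝ≥0) * h) :=
  measurable_pi_lambda _ fun _ => (measurable_pi_apply _).sub (measurable_pi_apply _)

/-- **The grid increments of a Brownian vector are i.i.d. Gaussian**: the law of
`(W_{(i+1)h} - W_{ih})_{i<n}` is `⊗_{i<n} gaussVec d h`. [folklore] -/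
theorem map_increments_eq_pi {Ω : Type*} [MeasurableSpace Ω] {P : Measure Ω} [IsProbabilityMeasure P] {d : ℕ}
    {W : ℝ≥0 → Ω → (Fin d → ℝ)} (hW : IsBrownianVec W P) (h : ℝ≥0) : ∀ n : ℕ,
    P.map (fun ω => fun i : Fin n => W ((((i : ℕ) + 1 : ℕ) : ℝ≥0) * h) ω - W (((i : ℕ) : ℝ≥0) * h) ω) =
      Measure.pi fun _ : Fin n => gaussVec d h := by
  intro n
  induction n with
  | zero =>
    haveI : IsProbabilityMeasure (gaussVec d h) := by unfold gaussVec; infer_instance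
    rw [Measure.pi_of_empty (x := fun i => Fin.elim0 i)]
    have hconst : (fun ω : Ω => fun i : Fin 0 => W ((((i : ℕ) + 1 : ℕ) : ℝ≥0) * h) ω - W (((i : ℕ) : ℝ≥0) * h) ω) =
        fun _ => fun i => Fin.elim0 i := funext fun ω => funext fun i => Fin.elim0 i
    rw [hconst, Measure.map_const, measure_univ, one_smul]
  | succ n ih =>
    haveI : IsProbabilityMeasure (gaussVec d h) := by unfold gaussVec; infer_instance
    -- increments as a functional of the path
    set incr : ∀ m : ℕ, (ℝ≥0 → (Fin d → ℝ)) → (Fin m → (Fin d → ℝ)) := fun m p i =>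
      p ((((i : ℕ) + 1 : ℕ) : ℝ≥0) * h) - p (((i : ℕ) : ℝ≥0) * h) with hincr
    have hmincr : ∀ m, Measurable (incr m) := fun m => measurable_pathIncrements d m h
    -- the first increment `W_h` and the later increments as a functional of the shifted path
    have hfirst : ∀ ω, W ((((0 : ℕ) + 1 : ℕ) : ℝ≥0) * h) ω - W (((0 : ℕ) : ℝ≥0) * h) ω = W h ω := by
      intro ω; simp [hW.apply_zero ω]
    have hlater : ∀ ω (i : Fin n), W ((((i.succ : ℕ) + 1 : ℕ) : ℝ≥0) * h) ω - W (((i.succ : ℕ) : ℝ≥0) * h) ω =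
        incr n (vecShift W h ω) i := by
      intro ω i
      simp only [hincr, vecShift, Fin.val_succ]
      have e1 : h + ((((i : ℕ) + 1 : ℕ) : ℝ≥0) * h) = ((((i : ℕ) + 1 + 1 : ℕ) : ℝ≥0) * h) := by push_cast; ring
      have e2 : h + ((((i : ℕ) : ℕ) : ℝ≥0) * h) = ((((i : ℕ) + 1 : ℕ) : ℝ≥0) * h) := by push_cast; ring
      rw [e1, e2]; ring
    -- decomposition through `Fin.cons`
    have hdecomp : (fun ω => fun i : Fin (n + 1) => W ((((i : ℕ) + 1 : ℕ) : ℝ≥0) * h) ω - W (((i : ℕ) : ℝ≥0) * h) ω) =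
        fun ω => Fin.cons (W h ω) (incr n (vecShift W h ω)) := by
      funext ω; funext i
      refine Fin.cases ?_ (fun j => ?_) i
      · rw [Fin.cons_zero]; exact hfirst ω
      · rw [Fin.cons_succ]; exact hlater ω j
    rw [hdecomp]
    -- independence of the two blocks and their laws
    have hm1 : Measurable (W h) := hW.measurable h
    have hm2 : Measurable fun ω => incr n (vecShift W h ω) := (hmincr n).comp (hW.measurable_vecShift h)
    have hind : IndepFun (fun ω => incr n (vecShift W h ω)) (W h) P := by
      have h0 : IndepFun (vecShift W h) (vecPast W h) P := hW.indep_shift h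
      have h1 : W h = (fun q : Set.Iic h → (Fin d → ℝ) => q ⟨h, Set.mem_Iic.2 le_rfl⟩) ∘ vecPast W h := rfl
      rw [h1]
      exact h0.comp (hmincr n) (measurable_pi_apply _)
    have hlaw2 : P.map (fun ω => incr n (vecShift W h ω)) = Measure.pi fun _ : Fin n => gaussVec d h := by
      have hc1 : (fun ω => incr n (vecShift W h ω)) = incr n ∘ vecShift W h := rfl
      have hc2 : (fun ω => fun i : Fin n => W ((((i : ℕ) + 1 : ℕ) : ℝ≥0) * h) ω - W (((i : ℕ) : ℝ≥0) * h) ω) =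
          incr n ∘ vecPath W := rfl
      rw [hc1, ← Measure.map_map (hmincr n) (hW.measurable_vecShift h), hW.map_shift h,
        Measure.map_map (hmincr n) hW.measurable_vecPath, ← hc2]
      exact ih
    have hlaw1 : P.map (W h) = gaussVec d h := hW.map_apply h
    have hpair : P.map (fun ω => (W h ω, incr n (vecShift W h ω))) =
        (gaussVec d h).prod (Measure.pi fun _ : Fin n => gaussVec d h) := by
      rw [← hlaw2, ← hlaw1]
      exact (indepFun_iff_map_prod_eq_prod_map_map hm1.aemeasurable hm2.aemeasurable).1 hind.symm
    -- transport along `Fin.cons`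
    set e := MeasurableEquiv.piFinSuccAbove (fun _ : Fin (n + 1) => Fin d → ℝ) 0 with he
    have hmp : MeasurePreserving e (Measure.pi fun _ : Fin (n + 1) => gaussVec d h)
        ((gaussVec d h).prod (Measure.pi fun _ : Fin n => gaussVec d h)) :=
      measurePreserving_piFinSuccAbove (fun _ : Fin (n + 1) => gaussVec d h) 0
    have hsymm : ∀ p : (Fin d → ℝ) × (Fin n → (Fin d → ℝ)),
        e.symm p = (Fin.cons p.1 p.2 : Fin (n + 1) → (Fin d → ℝ)) := by
      intro p
      rw [he, MeasurableEquiv.piFinSuccAbove_symm_apply]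
      exact Fin.insertNth_zero' p.1 p.2
    have hcons : (fun ω => (Fin.cons (W h ω) (incr n (vecShift W h ω)) : Fin (n + 1) → (Fin d → ℝ))) =
        e.symm ∘ fun ω => (W h ω, incr n (vecShift W h ω)) := by
      funext ω
      rw [Function.comp_apply, hsymm]
    rw [hcons, ← Measure.map_map e.symm.measurable (hm1.prodMk hm2), hpair]
    exact hmp.symm.map_eq

end Summit.QuantumFields.YangMills.Theorems.ColdStartUniversality

end
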